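import Summits.KontsevichZagierPeriods.KontsevichZagierPeriods.Theses.FurushoPentagon
import Summits.KontsevichZagierPeriods.KontsevichZagierPeriods.Theorems.HoffmanRelationInKZ.Negative.HoffmanElement
import Summits.KontsevichZagierPeriods.KontsevichZagierPeriods.Theorems.FurushoPentagonHoffmanRelationInKZStuffleDissectionAux
import Literature.NumberTheory.Transcendental.KZProductIdeal
import Literature.NumberTheory.Transcendental.KZUnfolding
import Literature.NumberTheory.Transcendental.KZLogCalculusProofs
import Literature.NumberTheory.Transcendental.MZVWordShuffle
import Literature.NumberTheory.Transcendental.MZVSimplexRepProofs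
import Literature.NumberTheory.Transcendental.SemialgebraicMapsProofs
import Literature.NumberTheory.Transcendental.NashCubes

/-!
# `HoffmanRelationInKZ`, line `dilation-homotopy-transposition`: stub `stub_stuffleDissection`

The STUFFLE SIDE of Hoffman's relation in the Kontsevich–Zagier calculus. For a non-empty admissible
index `s` (weight `n`, depth `k`), cubical integrand `f_s(x) = ∏_{l<k} T_{p_l}(x)/(1 − T_{p_{l+1}}(x))`
(`T_m = x₀⋯x_{m−1}`, block ends `p_l = s₁ + ⋯ + s_l`) and shear `σ_c x = (c x₀, x₁, …)`, the
representation `B_s = [(0,1)ⁿ⁺¹, (f_s(x) − u f_s(σ_u x))/(1 − u)]` exists and, for every cubically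
pinned assignment `C`, is congruent modulo `KZ.relations` to `∑_{i<k} (C(…, s_i + 1, …) + C(…, s_{i+1}, 1, …))`.

Proof: on the open cube the integrand splits EXACTLY (telescoping partial fractions,
`stuffle_telescope`) into the `2k` cubical integrands of the raised / inserted indices read at the point
with `u` moved into block `i` (`cubical_raise_at_perm`, `cubical_insertOne_at_perm`); each of these is
the integrand of a coordinate permutation (`KZ.IntegralRep.reindex`, a change-of-variables move
`KZ.of_sub_of_reindex_mem_relations`) of the pinned cubical representation, and the splitting is
iterated integrand additivity (`KZ.of_sub_of_sub_sum_mem_relations`).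

References: K. Ihara, M. Kaneko, D. Zagier, *Derivation and double shuffle relations for multiple zeta
values*, Compos. Math. 142 (2006), Thm 2; M. Kontsevich, D. Zagier, *Periods* (2001), §1.2.
-/

noncomputable section

open Set MeasureTheory Finset
open Literature.NumberTheory.Transcendental

namespace Summit.KontsevichZagierPeriods.FurushoPentagon.HoffmanRelationInKZ

/-! ### The cubical integrands of the raised / inserted index at the permuted point -/

/-- Partial products at the point `j ↦ y (e j)`, `e = cast ≫ cycleRange P` (the point `y` with its
`0`-th coordinate moved to slot `P`). [folklore] -/
theorem prod_ite_comp_equiv {n N : ℕ} (hw : N = n + 1) (y : Fin (n + 1) → ℝ) (P : Fin (n + 1))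
    (e : Fin N ≃ Fin (n + 1)) (he : ∀ j, e j = P.cycleRange (Fin.cast hw j)) (m : ℕ) :
    ∏ j : Fin N, (if (j : ℕ) < m then y (e j) else 1) =
      if m ≤ (P : ℕ) then ∏ i : Fin n, (if (i : ℕ) < m then y i.succ else 1)
      else y 0 * ∏ i : Fin n, (if (i : ℕ) < m - 1 then y i.succ else 1) := by
  rw [← prod_ite_cycleRange y P m]
  exact Fintype.prod_equiv (finCongr hw) _ _ fun j => by rw [finCongr_apply, Fin.val_cast, he]

/-- **The cubical integrand of the raised index `(…, s_i + 1, …)` at the point with `u = y 0`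
inserted at the first slot of block `i`** is `∏_{l<k} (l ≤ i ? a_l : u a_l)/(1 − (l+1 ≤ i ? a_{l+1} : u a_{l+1}))`,
`a_m = ∏_{j < p_m} y_{j+1}`; stated for any index `u` with the block ends of the raised index. [folklore] -/
theorem cubical_raise_at_perm (s u : List ℕ) {i : ℕ} (hlen : u.length = s.length)
    (hblk : ∀ m, (u.take m).sum = if m ≤ i then (s.take m).sum else (s.take m).sum + 1)
    (y : Fin (MZV.weight s + 1) → ℝ) (P : Fin (MZV.weight s + 1)) (hP : (P : ℕ) = (s.take i).sum)
    (hw : MZV.weight u = MZV.weight s + 1) (e : Fin (MZV.weight u) ≃ Fin (MZV.weight s + 1))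
    (he : ∀ j, e j = P.cycleRange (Fin.cast hw j)) :
    ∏ l : Fin u.length,
        (∏ j : Fin (MZV.weight u), if (j : ℕ) < (u.take l).sum then y (e j) else 1) /
          (1 - ∏ j : Fin (MZV.weight u), if (j : ℕ) < (u.take ((l : ℕ) + 1)).sum then y (e j) else 1) =
      ∏ l ∈ range s.length,
        (if l ≤ i then (∏ j : Fin (MZV.weight s), if (j : ℕ) < (s.take l).sum then y j.succ else 1)
          else y 0 * ∏ j : Fin (MZV.weight s), if (j : ℕ) < (s.take l).sum then y j.succ else 1) /
        (1 - (if l + 1 ≤ i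
          then (∏ j : Fin (MZV.weight s), if (j : ℕ) < (s.take (l + 1)).sum then y j.succ else 1)
          else y 0 * ∏ j : Fin (MZV.weight s), if (j : ℕ) < (s.take (l + 1)).sum then y j.succ else 1)) := by
  simp_rw [prod_ite_comp_equiv hw y P e he]
  rw [← hlen, ← Fin.prod_univ_eq_prod_range]
  refine Finset.prod_congr rfl fun l _ => ?_
  rw [hblk, hblk, hP]
  congr 1
  · by_cases hli : (l : ℕ) ≤ i
    · rw [if_pos hli, if_pos (sum_take_mono s hli), if_pos hli]
    · have := sum_take_mono s (le_of_not_ge hli)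
      rw [if_neg hli, if_neg (by omega), if_neg hli, Nat.add_sub_cancel]
  · congr 1
    by_cases hli : (l : ℕ) + 1 ≤ i
    · rw [if_pos hli, if_pos (sum_take_mono s hli), if_pos hli]
    · have := sum_take_mono s (le_of_not_ge hli)
      rw [if_neg hli, if_neg (by omega), if_neg hli, Nat.add_sub_cancel]

/-- **The cubical integrand of the inserted index `(…, s_{i+1}, 1, …)` at the point with `u = y 0`
inserted after block `i + 1`** is `∏_{l<k+1} (l ≤ i+1 ? a_l : u a_{l-1})/(1 − (l ≤ i ? a_{l+1} : u a_l))`;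
stated for any index `u` with the block ends of the inserted index. [folklore] -/
theorem cubical_insertOne_at_perm (s u : List ℕ) {i : ℕ} (hlen : u.length = s.length + 1)
    (hblk : ∀ m, (u.take m).sum = if m ≤ i + 1 then (s.take m).sum else (s.take (m - 1)).sum + 1)
    (y : Fin (MZV.weight s + 1) → ℝ) (P : Fin (MZV.weight s + 1)) (hP : (P : ℕ) = (s.take (i + 1)).sum)
    (hw : MZV.weight u = MZV.weight s + 1) (e : Fin (MZV.weight u) ≃ Fin (MZV.weight s + 1))
    (he : ∀ j, e j = P.cycleRange (Fin.cast hw j)) :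
    ∏ l : Fin u.length,
        (∏ j : Fin (MZV.weight u), if (j : ℕ) < (u.take l).sum then y (e j) else 1) /
          (1 - ∏ j : Fin (MZV.weight u), if (j : ℕ) < (u.take ((l : ℕ) + 1)).sum then y (e j) else 1) =
      ∏ l ∈ range (s.length + 1),
        (if l ≤ i + 1 then (∏ j : Fin (MZV.weight s), if (j : ℕ) < (s.take l).sum then y j.succ else 1)
          else y 0 * ∏ j : Fin (MZV.weight s), if (j : ℕ) < (s.take (l - 1)).sum then y j.succ else 1) /
        (1 - (if l ≤ i
          then (∏ j : Fin (MZV.weight s), if (j : ℕ) < (s.take (l + 1)).sum then y j.succ else 1)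
          else y 0 * ∏ j : Fin (MZV.weight s), if (j : ℕ) < (s.take l).sum then y j.succ else 1)) := by
  simp_rw [prod_ite_comp_equiv hw y P e he]
  rw [← hlen, ← Fin.prod_univ_eq_prod_range]
  refine Finset.prod_congr rfl fun l _ => ?_
  rw [hblk, hblk, hP]
  congr 1
  · by_cases hli : (l : ℕ) ≤ i + 1
    · rw [if_pos hli, if_pos (sum_take_mono s hli), if_pos hli]
    · have := sum_take_mono s (show i + 1 ≤ (l : ℕ) - 1 by omega)
      rw [if_neg hli, if_neg (by omega), if_neg hli, Nat.add_sub_cancel]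
  · congr 1
    by_cases hli : (l : ℕ) ≤ i
    · rw [if_pos (Nat.succ_le_succ hli), if_pos (sum_take_mono s (Nat.succ_le_succ hli)), if_pos hli]
    · have := sum_take_mono s (show i + 1 ≤ (l : ℕ) by omega)
      rw [if_neg (fun h => hli (Nat.le_of_succ_le_succ h)), Nat.add_sub_cancel, if_neg (by omega),
        if_neg hli, Nat.add_sub_cancel]

/-- **The stuffle integrand splits on the open cube**: `(f(x) − u f(σ_u x))/(1 − u) = ∑_{i<k} (g_i + h_i)`
with `g_i`, `h_i` the closed forms of `cubical_raise_at_perm` / `cubical_insertOne_at_perm`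
(`y = (u, x)`). [cite: IharaKanekoZagier2006, Thm 2] -/
theorem stuffle_integrand_eq (s : List ℕ) (hs : MZV.IsAdmissible s) (hne : s ≠ [])
    (f : (Fin (MZV.weight s) → ℝ) → ℝ) (σ : ℝ → (Fin (MZV.weight s) → ℝ) → (Fin (MZV.weight s) → ℝ))
    (hf : ∀ x, f x = ∏ l : Fin s.length, (∏ j : Fin (MZV.weight s),
      if (j : ℕ) < (s.take l).sum then x j else 1) / (1 - (∏ j : Fin (MZV.weight s),
      if (j : ℕ) < (s.take ((l : ℕ) + 1)).sum then x j else 1)))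
    (hσ : ∀ (c : ℝ) (x : Fin (MZV.weight s) → ℝ) (j : Fin (MZV.weight s)),
      σ c x j = if (j : ℕ) = 0 then c * x j else x j)
    (y : Fin (MZV.weight s + 1) → ℝ) (hy : ∀ i, y i ∈ Set.Ioo (0 : ℝ) 1) :
    (f (Fin.tail y) - y 0 * f (σ (y 0) (Fin.tail y))) / (1 - y 0) =
      ∑ i ∈ range s.length,
        ((∏ l ∈ range s.length,
          (if l ≤ i then (∏ j : Fin (MZV.weight s), if (j : ℕ) < (s.take l).sum then y j.succ else 1)
            else y 0 * ∏ j : Fin (MZV.weight s), if (j : ℕ) < (s.take l).sum then y j.succ else 1) /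
          (1 - (if l + 1 ≤ i
            then (∏ j : Fin (MZV.weight s), if (j : ℕ) < (s.take (l + 1)).sum then y j.succ else 1)
            else y 0 * ∏ j : Fin (MZV.weight s),
              if (j : ℕ) < (s.take (l + 1)).sum then y j.succ else 1))) +
        ∏ l ∈ range (s.length + 1),
          (if l ≤ i + 1 then (∏ j : Fin (MZV.weight s), if (j : ℕ) < (s.take l).sum then y j.succ else 1)
            else y 0 * ∏ j : Fin (MZV.weight s), if (j : ℕ) < (s.take (l - 1)).sum then y j.succ else 1) /
          (1 - (if l ≤ i
            then (∏ j : Fin (MZV.weight s), if (j : ℕ) < (s.take (l + 1)).sum then y j.succ else 1)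
            else y 0 * ∏ j : Fin (MZV.weight s),
              if (j : ℕ) < (s.take l).sum then y j.succ else 1))) := by
  have hk : 1 ≤ s.length := List.length_pos_of_ne_nil hne
  have hp : ∀ m, 1 ≤ m → 0 < (s.take m).sum := by
    obtain ⟨b, t, rfl⟩ := List.exists_cons_of_ne_nil hne
    have hb : 2 ≤ b := hs.2 (List.cons_ne_nil b t)
    exact fun m hm => sum_take_pos (by omega) t hm
  have hn : 0 < MZV.weight s := by
    have := hp s.length hk
    rwa [List.take_length] at this
  have hy' : ∀ i : Fin (MZV.weight s), y i.succ ∈ Set.Ioo (0 : ℝ) 1 := fun i => hy i.succ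
  have ha1 : ∀ j, 1 ≤ j →
      (fun m => ∏ j : Fin (MZV.weight s), if (j : ℕ) < (s.take m).sum then y j.succ else 1) j < 1 :=
    fun j hj => prod_ite_lt_one hn (fun i => y i.succ) hy' (hp j hj)
  have key := stuffle_telescope
    (a := fun m => ∏ j : Fin (MZV.weight s), if (j : ℕ) < (s.take m).sum then y j.succ else 1)
    hk (hy 0).1 (hy 0).2 ha1
  rw [← key]
  have htail : Fin.tail y = fun i => y i.succ := rfl
  rw [htail, hf, hf]
  simp_rw [prod_ite_shear hn (y 0) (fun i => y i.succ) (σ (y 0) fun i => y i.succ)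
    (hσ (y 0) fun i => y i.succ)]
  rw [Fin.prod_univ_eq_prod_range (fun l => (∏ j : Fin (MZV.weight s),
      if (j : ℕ) < (s.take l).sum then y j.succ else 1) / (1 - ∏ j : Fin (MZV.weight s),
      if (j : ℕ) < (s.take (l + 1)).sum then y j.succ else 1)) s.length,
    Fin.prod_univ_eq_prod_range (fun l => ((if 0 < (s.take l).sum then y 0 else 1) *
      ∏ j : Fin (MZV.weight s), if (j : ℕ) < (s.take l).sum then y j.succ else 1) /
      (1 - (if 0 < (s.take (l + 1)).sum then y 0 else 1) *
      ∏ j : Fin (MZV.weight s), if (j : ℕ) < (s.take (l + 1)).sum then y j.succ else 1)) s.length]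
  have hY : ∏ l ∈ range s.length, ((if 0 < (s.take l).sum then y 0 else 1) *
      ∏ j : Fin (MZV.weight s), if (j : ℕ) < (s.take l).sum then y j.succ else 1) /
      (1 - (if 0 < (s.take (l + 1)).sum then y 0 else 1) *
      ∏ j : Fin (MZV.weight s), if (j : ℕ) < (s.take (l + 1)).sum then y j.succ else 1) =
      ∏ l ∈ range s.length, (if l = 0 then 1 else y 0) *
      (∏ j : Fin (MZV.weight s), if (j : ℕ) < (s.take l).sum then y j.succ else 1) /
      (1 - y 0 * ∏ j : Fin (MZV.weight s), if (j : ℕ) < (s.take (l + 1)).sum then y j.succ else 1) := by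
    refine prod_congr rfl fun l _ => ?_
    rw [if_pos (hp (l + 1) (Nat.succ_pos l))]
    rcases Nat.eq_zero_or_pos l with rfl | hl0
    · rw [if_neg (by simp), if_pos rfl]
    · rw [if_pos (hp l hl0), if_neg hl0.ne']
  rw [hY]

open Summit.KontsevichZagierPeriods.HoffmanRelationInKZ.Negative (raise isAdmissible_raise
  list_sum_range_map_fin)

/-- The domain of a coordinate-permuted cubical representation is the cube. [folklore] -/
theorem reindex_cube_domain {N M : ℕ} (r : KZ.IntegralRep N)
    (hr : r.domain = {x : Fin N → ℝ | ∀ i, x i ∈ Set.Ioo (0 : ℝ) 1}) (e : Fin N ≃ Fin M) :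
    (r.reindex e).domain = {y : Fin M → ℝ | ∀ i, y i ∈ Set.Ioo (0 : ℝ) 1} := by
  rw [KZ.IntegralRep.reindex_domain, hr]
  ext y
  simp only [Set.mem_setOf_eq]
  exact ⟨fun h j => by simpa using h (e.symm j), fun h j => h _⟩

/-- STUB (stuffle side = block partial fractions).  For a non-empty admissible `s` (weight `n`, depth `k`) and
a cubically pinned `C`: the stuffle side `B_s = [(0,1)ⁿ⁺¹, (f_s(x) − u·f_s(u x₀, x'))/(1−u)]` EXISTS, and
every representation of that shape is, modulo `KZ.relations`, `∑_{i<k} (C(raise s i) + C(insertOne s i))`: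
with `a_l = T_{p_l}(x)` the integrand is the telescoping sum `∑_l (P_l − P_{l−1})/(1−u)`,
`P_l = u^{k−l}/(∏_{j≤l}(1−a_j) ∏_{j>l}(1−u a_j))`, and `(P_l − P_{l−1})/(1−u) = g_l + h_l` where
`g_l` / `h_l` are the cubical integrands of `(…, s_l + 1, …)` / `(…, s_l, 1, …)` in the variables
`(x, u)` with `u` placed inside block `l` / as a new block after block `l` (exact rational identities;
`2k − 1` integrand-additivity moves, all summands positive hence integrable), followed by one coordinate
permutation + dimension cast per summand (`KZ.of_sub_of_reindex_mem_relations`).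
[cite: IharaKanekoZagier2006, Thm 2] -/
theorem stub_stuffleDissection : ∀ (s : List ℕ), MZV.IsAdmissible s → s ≠ [] → ∀ (f : (Fin (MZV.weight s) → ℝ) → ℝ) (σ : ℝ → (Fin (MZV.weight s) → ℝ) → (Fin (MZV.weight s) → ℝ)), (∀ x, f x = ∏ l : Fin s.length, (∏ j : Fin (MZV.weight s), if (j : ℕ) < (s.take l).sum then x j else 1) / (1 - (∏ j : Fin (MZV.weight s), if (j : ℕ) < (s.take ((l : ℕ) + 1)).sum then x j else 1))) → (∀ (c : ℝ) (x : Fin (MZV.weight s) → ℝ) (j : Fin (MZV.weight s)), σ c x j = if (j : ℕ) = 0 then c * x j else x j) → ∀ C : List ℕ → KZ.FormalRep, (∀ (u : List ℕ), MZV.IsAdmissible u → u ≠ [] → ∃ r : KZ.IntegralRep (MZV.weight u), r.domain = {x : Fin (MZV.weight u) → ℝ | ∀ i, x i ∈ Set.Ioo (0:ℝ) 1} ∧ Set.EqOn r.integrand (fun x => ∏ l : Fin u.length, (∏ j : Fin (MZV.weight u), if (j : ℕ) < (u.take l).sum then x j else 1) / (1 - (∏ j : Fin (MZV.weight u), if (j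 : ℕ) < (u.take ((l : ℕ) + 1)).sum then x j else 1))) r.domain ∧ C u = KZ.of r) → (∃ r : KZ.IntegralRep (MZV.weight s + 1), (r.domain = {y : Fin (MZV.weight s + 1) → ℝ | ∀ i, y i ∈ Set.Ioo (0:ℝ) 1} ∧ Set.EqOn r.integrand (fun y => (f (Fin.tail y) - y 0 * f (σ (y 0) (Fin.tail y))) / (1 - y 0)) r.domain)) ∧ ∀ r : KZ.IntegralRep (MZV.weight s + 1), (r.domain = {y : Fin (MZV.weight s + 1) → ℝ | ∀ i, y i ∈ Set.Ioo (0:ℝ) 1} ∧ Set.EqOn r.integrand (fun y => (f (Fin.tail y) - y 0 * f (σ (y 0) (Fin.tail y))) / (1 - y 0)) r.domain) → KZ.of r - ((List.range s.length).map (fun i => C (s.take i ++ [s.getD i 0 + 1] ++ s.drop (i + 1)) + C (s.take (i + 1) ++ [1] ++ s.drop (i + 1)))).sum ∈ KZ.relations := by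
  intro s hs hne f σ hf hσ C hC
  -- the pinned cubical representations
  choose ρ hρd hρi hρC using hC
  -- the raised indices
  have hadm_r : ∀ i : Fin s.length,
      MZV.IsAdmissible (s.take i ++ [s.getD i 0 + 1] ++ s.drop (i + 1)) :=
    fun i => isAdmissible_raise hs i.2
  have hne_r : ∀ i : Fin s.length, s.take i ++ [s.getD i 0 + 1] ++ s.drop (i + 1) ≠ [] :=
    fun i => by simp
  have hw_r : ∀ i : Fin s.length,
      MZV.weight (s.take i ++ [s.getD i 0 + 1] ++ s.drop (i + 1)) = MZV.weight s + 1 :=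
    fun i => sum_raise' s i i.2
  -- the inserted indices
  have hadm_h : ∀ i : Fin s.length, MZV.IsAdmissible (s.take (i + 1) ++ [1] ++ s.drop (i + 1)) := by
    intro i
    obtain ⟨b, t, rfl⟩ := List.exists_cons_of_ne_nil hne
    refine ⟨fun x hx => ?_, fun _ => ?_⟩
    · simp only [List.mem_append, List.mem_singleton] at hx
      rcases hx with (hx | rfl) | hx
      · exact hs.1 x (List.mem_of_mem_take hx)
      · exact le_rfl
      · exact hs.1 x (List.mem_of_mem_drop hx)
    · simpa using hs.2 (List.cons_ne_nil b t)
  have hne_h : ∀ i : Fin s.length, s.take (i + 1) ++ [1] ++ s.drop (i + 1) ≠ [] := fun i => by simp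
  have hw_h : ∀ i : Fin s.length,
      MZV.weight (s.take (i + 1) ++ [1] ++ s.drop (i + 1)) = MZV.weight s + 1 :=
    fun i => sum_insertOne s i i.2
  -- the slots of `u`
  let Pr : Fin s.length → Fin (MZV.weight s + 1) :=
    fun i => ⟨(s.take i).sum, Nat.lt_succ_of_le (sum_take_le_sum s i)⟩
  let Ph : Fin s.length → Fin (MZV.weight s + 1) :=
    fun i => ⟨(s.take (i + 1)).sum, Nat.lt_succ_of_le (sum_take_le_sum s (i + 1))⟩
  let er : ∀ i : Fin s.length,
      Fin (MZV.weight (s.take i ++ [s.getD i 0 + 1] ++ s.drop (i + 1))) ≃ Fin (MZV.weight s + 1) :=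
    fun i => (finCongr (hw_r i)).trans (Pr i).cycleRange
  let eh : ∀ i : Fin s.length,
      Fin (MZV.weight (s.take (i + 1) ++ [1] ++ s.drop (i + 1))) ≃ Fin (MZV.weight s + 1) :=
    fun i => (finCongr (hw_h i)).trans (Ph i).cycleRange
  have her : ∀ (i : Fin s.length) j, er i j = (Pr i).cycleRange (Fin.cast (hw_r i) j) := fun i j => rfl
  have heh : ∀ (i : Fin s.length) j, eh i j = (Ph i).cycleRange (Fin.cast (hw_h i) j) := fun i j => rfl
  -- the pieces: coordinate permutations of the pinned cubical representations
  let Rr : Fin s.length → KZ.IntegralRep (MZV.weight s + 1) :=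
    fun i => (ρ _ (hadm_r i) (hne_r i)).reindex (er i)
  let Rh : Fin s.length → KZ.IntegralRep (MZV.weight s + 1) :=
    fun i => (ρ _ (hadm_h i) (hne_h i)).reindex (eh i)
  have hRr_dom : ∀ i, (Rr i).domain = {y : Fin (MZV.weight s + 1) → ℝ | ∀ j, y j ∈ Set.Ioo (0:ℝ) 1} :=
    fun i => reindex_cube_domain _ (hρd _ _ _) _
  have hRh_dom : ∀ i, (Rh i).domain = {y : Fin (MZV.weight s + 1) → ℝ | ∀ j, y j ∈ Set.Ioo (0:ℝ) 1} :=
    fun i => reindex_cube_domain _ (hρd _ _ _) _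
  have hRr_int : ∀ (i : Fin s.length) (y : Fin (MZV.weight s + 1) → ℝ), (∀ j, y j ∈ Set.Ioo (0:ℝ) 1) →
      (Rr i).integrand y = ∏ l ∈ range s.length,
        (if l ≤ i then (∏ j : Fin (MZV.weight s), if (j : ℕ) < (s.take l).sum then y j.succ else 1)
          else y 0 * ∏ j : Fin (MZV.weight s), if (j : ℕ) < (s.take l).sum then y j.succ else 1) /
        (1 - (if l + 1 ≤ i
          then (∏ j : Fin (MZV.weight s), if (j : ℕ) < (s.take (l + 1)).sum then y j.succ else 1)
          else y 0 * ∏ j : Fin (MZV.weight s),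
            if (j : ℕ) < (s.take (l + 1)).sum then y j.succ else 1)) := by
    intro i y hy
    have hmem : (fun j => y (er i j)) ∈ (ρ _ (hadm_r i) (hne_r i)).domain := by
      rw [hρd]; exact fun j => hy _
    show (ρ _ (hadm_r i) (hne_r i)).integrand (fun j => y (er i j)) = _
    rw [hρi _ _ _ hmem]
    exact cubical_raise_at_perm s _ (length_raise' s i i.2) (fun m => sum_take_raise' s i m i.2) y
      (Pr i) rfl (hw_r i) (er i) (her i)
  have hRh_int : ∀ (i : Fin s.length) (y : Fin (MZV.weight s + 1) → ℝ), (∀ j, y j ∈ Set.Ioo (0:ℝ) 1) →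
      (Rh i).integrand y = ∏ l ∈ range (s.length + 1),
        (if l ≤ i + 1 then (∏ j : Fin (MZV.weight s), if (j : ℕ) < (s.take l).sum then y j.succ else 1)
          else y 0 * ∏ j : Fin (MZV.weight s), if (j : ℕ) < (s.take (l - 1)).sum then y j.succ else 1) /
        (1 - (if l ≤ i
          then (∏ j : Fin (MZV.weight s), if (j : ℕ) < (s.take (l + 1)).sum then y j.succ else 1)
          else y 0 * ∏ j : Fin (MZV.weight s),
            if (j : ℕ) < (s.take l).sum then y j.succ else 1)) := by
    intro i y hy
    have hmem : (fun j => y (eh i j)) ∈ (ρ _ (hadm_h i) (hne_h i)).domain := by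
      rw [hρd]; exact fun j => hy _
    show (ρ _ (hadm_h i) (hne_h i)).integrand (fun j => y (eh i j)) = _
    rw [hρi _ _ _ hmem]
    exact cubical_insertOne_at_perm s _ (length_insertOne s i i.2)
      (fun m => sum_take_insertOne s i m i.2) y (Ph i) rfl (hw_h i) (eh i) (heh i)
  -- the dissection of the stuffle integrand on the cube
  have hsplit : ∀ y : Fin (MZV.weight s + 1) → ℝ, (∀ j, y j ∈ Set.Ioo (0:ℝ) 1) →
      (f (Fin.tail y) - y 0 * f (σ (y 0) (Fin.tail y))) / (1 - y 0) =
        ∑ i : Fin s.length, ((Rr i).integrand y + (Rh i).integrand y) := by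
    intro y hy
    rw [stuffle_integrand_eq s hs hne f σ hf hσ y hy,
      ← Fin.sum_univ_eq_sum_range (fun i => (∏ l ∈ range s.length,
        (if l ≤ i then (∏ j : Fin (MZV.weight s), if (j : ℕ) < (s.take l).sum then y j.succ else 1)
          else y 0 * ∏ j : Fin (MZV.weight s), if (j : ℕ) < (s.take l).sum then y j.succ else 1) /
        (1 - (if l + 1 ≤ i
          then (∏ j : Fin (MZV.weight s), if (j : ℕ) < (s.take (l + 1)).sum then y j.succ else 1)
          else y 0 * ∏ j : Fin (MZV.weight s),
            if (j : ℕ) < (s.take (l + 1)).sum then y j.succ else 1))) +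
        ∏ l ∈ range (s.length + 1),
        (if l ≤ i + 1 then (∏ j : Fin (MZV.weight s), if (j : ℕ) < (s.take l).sum then y j.succ else 1)
          else y 0 * ∏ j : Fin (MZV.weight s), if (j : ℕ) < (s.take (l - 1)).sum then y j.succ else 1) /
        (1 - (if l ≤ i
          then (∏ j : Fin (MZV.weight s), if (j : ℕ) < (s.take (l + 1)).sum then y j.succ else 1)
          else y 0 * ∏ j : Fin (MZV.weight s),
            if (j : ℕ) < (s.take l).sum then y j.succ else 1))) s.length]
    exact Finset.sum_congr rfl fun i _ => by rw [hRr_int i y hy, hRh_int i y hy]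
  -- semialgebraicity and integrability of the split sum on the cube
  have hcube : Literature.ModelTheory.ExponentialFields.IsSemialgebraic ℚ
      {y : Fin (MZV.weight s + 1) → ℝ | ∀ j, y j ∈ Set.Ioo (0:ℝ) 1} := isSemialgebraic_openUnitCube
  have hsa : IsSemialgebraicFunOn ℚ {y : Fin (MZV.weight s + 1) → ℝ | ∀ j, y j ∈ Set.Ioo (0:ℝ) 1}
      (fun y => (f (Fin.tail y) - y 0 * f (σ (y 0) (Fin.tail y))) / (1 - y 0)) := by
    refine (KZ.isSemialgebraicFunOn_finset_sum Finset.univ hcube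
      (f := fun i y => (Rr i).integrand y + (Rh i).integrand y) fun i _ => ?_).congr
      fun y hy => (hsplit y hy).symm
    exact IsSemialgebraicFunOn.add_holds (hRr_dom i ▸ (Rr i).isSemialgebraicFunOn_integrand)
      (hRh_dom i ▸ (Rh i).isSemialgebraicFunOn_integrand)
  have hint : IntegrableOn (fun y => (f (Fin.tail y) - y 0 * f (σ (y 0) (Fin.tail y))) / (1 - y 0))
      {y : Fin (MZV.weight s + 1) → ℝ | ∀ j, y j ∈ Set.Ioo (0:ℝ) 1} := by
    refine IntegrableOn.congr_fun (f := fun y => ∑ i : Fin s.length,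
      ((Rr i).integrand y + (Rh i).integrand y)) ?_ (fun y hy => (hsplit y hy).symm)
      isOpen_openUnitCube.measurableSet
    exact integrable_finsetSum _ fun i _ =>
      (hRr_dom i ▸ (Rr i).integrableOn).add (hRh_dom i ▸ (Rh i).integrableOn)
  refine ⟨⟨⟨{y | ∀ j, y j ∈ Set.Ioo (0:ℝ) 1}, fun y => (f (Fin.tail y) - y 0 * f (σ (y 0) (Fin.tail y))) /
    (1 - y 0), hcube, hsa, hint⟩, rfl, fun y _ => rfl⟩, ?_⟩
  -- the relation
  rintro r ⟨hrd, hri⟩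
  obtain ⟨Z, hZd, hZi⟩ := KZ.exists_zeroRep (n := MZV.weight s + 1) hcube
  have hZ : KZ.of Z ∈ KZ.relations := KZ.of_mem_relations_of_eqOn_zero Z (by rw [hZi]; exact fun _ _ => rfl)
  have hmain : KZ.of r - KZ.of Z - ∑ i, KZ.of (Fin.append Rr Rh i) ∈ KZ.relations := by
    refine KZ.of_sub_of_sub_sum_mem_relations (s.length + s.length) r Z (Fin.append Rr Rh)
      (hZd.trans hrd.symm) (fun i => ?_) fun y hy => ?_
    · refine Fin.addCases (fun i => ?_) (fun i => ?_) i
      · rw [Fin.append_left]; exact (hRr_dom i).trans hrd.symm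
      · rw [Fin.append_right]; exact (hRh_dom i).trans hrd.symm
    · rw [hrd] at hy
      rw [hri (hrd ▸ hy)]
      beta_reduce
      rw [hZi, Pi.zero_apply, zero_add, Fin.sum_univ_add]
      simp only [Fin.append_left, Fin.append_right]
      rw [hsplit y hy, ← Finset.sum_add_distrib]
  have hsum : ∑ i, KZ.of (Fin.append Rr Rh i) = ∑ i, KZ.of (Rr i) + ∑ i, KZ.of (Rh i) := by
    rw [Fin.sum_univ_add]; simp only [Fin.append_left, Fin.append_right]
  have hCr : ∀ i : Fin s.length,
      C (s.take i ++ [s.getD i 0 + 1] ++ s.drop (i + 1)) - KZ.of (Rr i) ∈ KZ.relations := by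
    intro i; rw [hρC _ (hadm_r i) (hne_r i)]; exact KZ.of_sub_of_reindex_mem_relations _ _
  have hCh : ∀ i : Fin s.length,
      C (s.take (i + 1) ++ [1] ++ s.drop (i + 1)) - KZ.of (Rh i) ∈ KZ.relations := by
    intro i; rw [hρC _ (hadm_h i) (hne_h i)]; exact KZ.of_sub_of_reindex_mem_relations _ _
  rw [list_sum_range_map_fin, Finset.sum_add_distrib]
  have key : KZ.of r - (∑ i : Fin s.length, C (s.take i ++ [s.getD i 0 + 1] ++ s.drop (i + 1)) +
      ∑ i : Fin s.length, C (s.take (i + 1) ++ [1] ++ s.drop (i + 1))) =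
      (KZ.of r - KZ.of Z - ∑ i, KZ.of (Fin.append Rr Rh i)) + KZ.of Z -
        (∑ i : Fin s.length, (C (s.take i ++ [s.getD i 0 + 1] ++ s.drop (i + 1)) - KZ.of (Rr i))) -
        ∑ i : Fin s.length, (C (s.take (i + 1) ++ [1] ++ s.drop (i + 1)) - KZ.of (Rh i)) := by
    rw [hsum, Finset.sum_sub_distrib, Finset.sum_sub_distrib]; abel
  rw [key]
  exact KZ.relations.sub_mem (KZ.relations.sub_mem (KZ.relations.add_mem hmain hZ)
    (KZ.relations.sum_mem fun i _ => hCr i)) (KZ.relations.sum_mem fun i _ => hCh i)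

end Summit.KontsevichZagierPeriods.FurushoPentagon.HoffmanRelationInKZ
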